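import Literature.AlgebraicGeometry.GroupSchemes.SectionsThroughFibreDenseOpens
import HarnessLib

/-!
# Sections through fibre-dense opens — the slice `(𝟙, x ∘ q)` in the SECOND factor

Topic `AlgebraicGeometry/GroupSchemes`, namespace `Literature.AlgebraicGeometry.GroupSchemes`.  ONE THEOREM
(no definition, no named fact, no instance, no `sorry`).  Cell `hodgecm-mathlib`, road W (r₀), (W1) step (G3b)
«StageSaturate», layer 2a.  `exists_open_forall_section_lift_mem` (this directory) produces sections `x` of
`p : V → S` with the point `(x ∘ q, 𝟙)(y)` of `V ×_S Y` in a given open `O` dense in the fibre of `pr₂` over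
`y`.  The translate charts of [Artin1986NeronModels] §2 (`V_s = V × s ⊂ V ×_S V`, slice `σ_s = (𝟙, s ∘ π)`,
`BirationalGroupLawTranslate`, `StageSaturateChart`) put the section in the SECOND factor: this file transports
the lemma along the factor swap `V ×_S Y ≅ Y ×_S V` (a homeomorphism, so «dense in the fibre of `pr₂` over
`y`» becomes «dense in the fibre of `pr₁` over `y`»).  HC_CM is proved only modulo the 7 printed citations until
rung 0 closes; banked leaf, no floor change.

## References
* [Artin1986NeronModels] M. Artin, *Néron models*, in Cornell–Silverman (eds.), *Arithmetic Geometry* (1986),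
  Thm. (1.12) and §2 (pp. 217, 221–223: «for `x` generic», the translates `V × x`).
* [EdixhovenRomagny] B. Edixhoven, M. Romagny, *Group schemes out of birational group laws, Néron models*,
  Panor. Synthèses 47 (2015), Def. 3.4 (2), Lemma 3.19.
-/

set_option autoImplicit false

noncomputable section

open CategoryTheory CategoryTheory.Limits AlgebraicGeometry TopologicalSpace Topology

namespace Literature.AlgebraicGeometry.GroupSchemes

universe u

variable {V Y S : Scheme.{u}} (p : V ⟶ S) (q : Y ⟶ S)

/-- **Sections through an open dense in the fibre over a point — second-factor slice.**  Let `p : V ⟶ S`,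
`q : Y ⟶ S`, `y ∈ Y` with `s = q y`, and let `O ⊆ Y ×_S V` be open and dense in the fibre of
`pr₁ : Y ×_S V ⟶ Y` over `y`.  If the fibre `V_s` is non-empty, there is an open `Ω ⊆ V` meeting `V_s` such that
for every section `x` of `p` with `x(s) ∈ Ω` the point `(y, x) = (𝟙, x ∘ q)(y)` of `Y ×_S V` lies in `O`.
(`exists_open_forall_section_lift_mem` transported along the swap `V ×_S Y ≅ Y ×_S V`.)  This is «choose the
section `x` generic» of [Artin1986NeronModels] §2 for the slices `V × x ⊂ V ×_S V` of the translate charts.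
[cite: Artin1986NeronModels, §2, proof of Thm. (1.12): Lemma 2.3 and the last paragraph (pp. 221–223)]
[cite: EdixhovenRomagny, Def. 3.4 (2) and Lemma 3.19] -/
theorem exists_open_forall_section_slice_mem (y : Y) (O : (pullback q p).Opens)
    (hO : (pullback.fst q p) ⁻¹' {y} ⊆ closure ((O : Set ↑(pullback q p)) ∩ (pullback.fst q p) ⁻¹' {y}))
    (hs : (p ⁻¹' {q y}).Nonempty) :
    ∃ Ω : V.Opens, ((Ω : Set V) ∩ p ⁻¹' {q y}).Nonempty ∧
      ∀ (x : S ⟶ V) (hx : x ≫ p = 𝟙 S), x (q y) ∈ Ω →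
        pullback.lift (𝟙 Y) (q ≫ x)
          (by rw [Category.assoc, hx, Category.comp_id, Category.id_comp]) y ∈ O := by
  -- the factor swap `sw : V ×_S Y ⟶ Y ×_S V` and its inverse
  let sw : pullback p q ⟶ pullback q p :=
    pullback.lift (pullback.snd p q) (pullback.fst p q) pullback.condition.symm
  let sw' : pullback q p ⟶ pullback p q :=
    pullback.lift (pullback.snd q p) (pullback.fst q p) pullback.condition.symm
  have hsw₁ : sw ≫ pullback.fst q p = pullback.snd p q := pullback.lift_fst _ _ _
  have hsw₂ : sw ≫ pullback.snd q p = pullback.fst p q := pullback.lift_snd _ _ _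
  have hsw'₁ : sw' ≫ pullback.fst p q = pullback.snd q p := pullback.lift_fst _ _ _
  have hsw'₂ : sw' ≫ pullback.snd p q = pullback.fst q p := pullback.lift_snd _ _ _
  have h₁ : sw ≫ sw' = 𝟙 _ := by
    refine pullback.hom_ext ?_ ?_
    · rw [Category.assoc, hsw'₁, hsw₂, Category.id_comp]
    · rw [Category.assoc, hsw'₂, hsw₁, Category.id_comp]
  have h₂ : sw' ≫ sw = 𝟙 _ := by
    refine pullback.hom_ext ?_ ?_
    · rw [Category.assoc, hsw₁, hsw'₂, Category.id_comp]
    · rw [Category.assoc, hsw₂, hsw'₁, Category.id_comp]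
  haveI : IsIso sw := ⟨sw', h₁, h₂⟩
  -- `pr₂ = pr₁ ∘ sw` on points
  have hsnd : ⇑(pullback.snd p q) = ⇑(pullback.fst q p) ∘ ⇑sw := by
    rw [← TopCat.coe_comp, ← Scheme.Hom.comp_base, hsw₁]
  -- the transported open `O' = sw⁻¹ O` is dense in the fibre of `pr₂` over `y`
  have hO' : (pullback.snd p q) ⁻¹' {y} ⊆
      closure (((sw ⁻¹ᵁ O : (pullback p q).Opens) : Set ↑(pullback p q)) ∩ (pullback.snd p q) ⁻¹' {y}) := by
    rw [hsnd, Set.preimage_comp]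
    change ⇑sw ⁻¹' ((pullback.fst q p) ⁻¹' {y}) ⊆
      closure (⇑sw ⁻¹' (O : Set ↑(pullback q p)) ∩ ⇑sw ⁻¹' ((pullback.fst q p) ⁻¹' {y}))
    rw [← Set.preimage_inter, show (⇑sw : ↑(pullback p q) → ↑(pullback q p)) = ⇑sw.homeomorph from rfl,
      ← Homeomorph.preimage_closure]
    exact Set.preimage_mono hO
  obtain ⟨Ω, hΩne, hΩ⟩ := exists_open_forall_section_lift_mem p q y (sw ⁻¹ᵁ O) hO' hs
  refine ⟨Ω, hΩne, fun x hx hxΩ => ?_⟩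
  have hmem := hΩ x hx hxΩ
  -- `sw ∘ (x ∘ q, 𝟙) = (𝟙, x ∘ q)`
  have hlift : pullback.lift (q ≫ x) (𝟙 Y) (by rw [Category.assoc, hx, Category.comp_id, Category.id_comp]) ≫ sw =
      pullback.lift (𝟙 Y) (q ≫ x) (by rw [Category.assoc, hx, Category.comp_id, Category.id_comp]) := by
    refine pullback.hom_ext ?_ ?_
    · rw [Category.assoc, hsw₁, pullback.lift_snd, pullback.lift_fst]
    · rw [Category.assoc, hsw₂, pullback.lift_fst, pullback.lift_snd]
  have : (pullback.lift (q ≫ x) (𝟙 Y) (by rw [Category.assoc, hx, Category.comp_id, Category.id_comp]) ≫ sw) y ∈ O :=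
    hmem
  rwa [hlift] at this

end Literature.AlgebraicGeometry.GroupSchemes

end
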